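import Mathlib
import Literature.Analysis.SpecialFunctions.RealGaussianComplexQuadratic
import Literature.MathematicalPhysics.QuantumFieldTheory.Balaban1983to89.T4CouplingAnalyticity

/-!
# T4ComplexDilation — the COMPLEX-DILATION MECHANISM behind the NOT-PRINTED hypothesis [H-dil] of node U3 (estimate NE9),
kernel-checked on a finite-dimensional ONE-BLOCK MODEL: DOMINATION of a dilated Boltzmann integral by the real-coupling
absolute-value theory, the Gaussian VOLUME FACTOR `(‖w‖/Re w)^{n/2} ≤ (1 − c²)^{−n/4} ≤ e^{n·c²/(4(1−c²))}` on the dilation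
discs `|w − s| ≤ c·s`, HOLOMORPHY in the complex coupling, and CAUCHY ⇒ LIPSCHITZ — ending in a GENUINE normalised Boltzmann
integral that inhabits, letter for letter, the binder `hlast` of `T4CouplingAnalyticity.stepTransfer_of_analyticOn` /
`ne9T_of_dilationStep` and fires the former BY NAME (cell `pub-balaban`, T4-DAG v21 §2 node U3 / §6 NE9; journal row
T4-U3.E-NE9-PROVE-P1h*; a MODEL of the mechanism with explicit constants, NO estimate of the cell's NEW-ESTIMATE kind for
Bałaban's activities, NOT summit progress).

HONEST FRAMING (T4-DAG PAGE 1).  The cell's T4 target is rung (B)+1: existence AND uniqueness of the ε → 0 limit of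
Bałaban's unit-scale averaged expectations on a FIXED finite torus — strictly beyond ultraviolet stability
([Balaban1988Convergent] Cor. 3 p. 264; [Balaban1989LargeFieldII] Thm 1 p. 355), and NOT infinite volume, NOT a mass gap,
NOT the Clay problem; the hypotheses BetaPertH, (B), (B^μ) of the cell's chain stay explicit and are untouched here (this
module uses none of them).  NE9 is NOT PRINTED (cell NEW ESTIMATE).  This module ASSERTS NOTHING about Bałaban's functionals:
every declaration is [folklore] — elementary complex analysis and Gaussian integration on objects DEFINED here — and the
manuscripts under audit are named for STRUCTURE only (ABSOLUTE RULE of the cell: no internally-minted statement enters as a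
cited fact; nothing printed in the audited series is used as a hypothesis).

WHAT [H-dil] IS AND WHY THIS MODEL.  The lineage `b2b-balaban-t4-ne9-p1` (NE9 prover P1, analytic-dependence route) reduced
the spine estimate NE9 (Lipschitz dependence of the step-k output functional on the coupling HISTORY, with fading memory) to
Cauchy constants of the one-step map (`T4CouplingAnalyticity` §§5–7, §14; sharpness and non-degeneracy of that reduction:
`T4CouplingAnalyticityWitness`).  The single member-specific input left on the route is (AN-LAST-dil) = [H-dil]: in
t-coordinates `t = 1/g²`, the step-j activity as a function of its OWN (last) coupling extends holomorphically to the RELATIVE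
discs `|z − s| ≤ c·s`, `s ≥ t₀`, with a uniform sup bound `M₁` — the binder `hlast` of `stepTransfer_of_analyticOn` /
`ne9T_of_dilationStep` (weighted variable-window form [H-dil-N]: `hlast` of `stepTransferV_of_analyticOn` with
`M₁ j = M·exp(−A₀(log t_j)^{p₀})`).  The located reading (L5) in the module docstring of `T4CouplingAnalyticity` records WHY
these discs are the natural domain — in the unscaled variables the last coupling enters the k-th step only as the prefactor
`1/g_k²` of the fluctuation action, so a complex last coupling at a REAL base point is a complex scalar DILATION
`Δ ↦ (1 + ζ)Δ`, `|ζ| ≤ c`, of the Gaussian form and of the `1/g_k²`-terms, every cut-off staying REAL — and names the two costs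
of a dilation: the Gaussian measure is no longer positive (to be handled by an absolute-value bound: positive Gaussian of the
real part, times a determinant ratio, times an error factor exponential in the number of variables), and every real-coupling
bound used must be stable under `t ↦ Re z ≥ (1 − c)·t`.  THIS LEAF KERNEL-CHECKS EXACTLY THAT MECHANISM IN FINITE DIMENSION,
WITH EXPLICIT CONSTANTS (§§1–6 below): the determinant ratio is `(‖w‖/Re w)^{n/2} ≤ (1 − c²)^{−n/4}`, so the admissible dilation
is `c²·n ≲ 1` per unit of sup-bound loss — for a block of `n` integration variables the cost is the factor `e^{n·c²/(4(1−c²))}`,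
of the shape "exponential of (small parameter) × (number of variables)".

PRINTED CONTEXT (STRUCTURE ONLY; render `b2b-balaban-ref1/pages/1987-cmp109-rg-I-small-field/…-p020-x2.png` = journal p. 268
of [Balaban1987RG1], re-read as an image by this seat; journal page = render page + 248).  The objects modelled are the
one-step fluctuation integrals of the inductive definition of the effective action.  P. 268: *"the measure becomes a Gaussian
measure in variables B, with the covariance C^{(k)} = C^{(k)}(U_{k+1}) = (C\*Δ^{(k)}C)^{−1}."*; *"After these transformations we
obtain the following expression for the new action:"* (2.12), whose fluctuation part reads *"+ log N_k″^{−1} ∫ dμ_{C^{(k)}}(B)χ_k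
exp[…]"* with, among the terms under the exponential, *"− (1/g_k²) G₃(g_kB)"* and *"− (1/g_k²) V(H₁(g_kCB − hD̃(g_kCB)))"* — the
coupling as the explicit prefactor `1/g_k²` —; *"Let us notice that the normalization constant N_k″ is equal to the integral
above at U_{k+1} = 1."*; *"E^{(k+1)}(g_k, U_{k+1}) = log ∫ dμ_{C^{(k)}}(B)χ_k exp[P^{(k)}(g_k, U_{k+1}, B) + {…}]. (2.13) Let us
remark that the expression under the exponential above vanishes at g_k = 0, and log N_k″ = E^{(k+1)}(g_k, 1). (2.14)"*.
DICTIONARY (model ↦ print; an ANALOGY fixing what is modelled, NOT an identification): reference measure `μ` on the block,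
with the cut-off characteristic functions and every coupling-free factor put into the density `f` ↦ `dμ_{C^{(k)}}(B)χ_k × (the
g-free factors)`; a bounded real action density `S` multiplied by the coupling `w` ↦ the `1/g_k²`-terms; `gaussNorm A w` ↦ the
Gaussian normalisation at the dilated covariance; `act = invNorm · blockInt` ↦ ONE normalised block integral, BEFORE the
logarithm of (2.13) and BEFORE any localisation / cluster expansion.  The (2.13)/(2.14) activities of Bałaban are NOT
instances of `act` — see WHAT THIS DOES NOT SHOW.

## What is typed and proved (all [folklore])

§1 DISC GEOMETRY (`re_ge_of_mem_dilDisc`, `norm_le_of_mem_dilDisc`, **`normSq_mul_le_re_sq_of_mem_dilDisc`**: on `|z − s| ≤ c·s`,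
   `(1 − c)s ≤ Re z`, `‖z‖ ≤ (1 + c)s` and `‖z‖²(1 − c²) ≤ (Re z)²` — equality at `Re(z/s − 1) = −c²` —, `re_pos_of_mem_dilDisc`),
   and the DILATION VOLUME CONSTANT `dilVol c n = (1 − c²)^{−n/4}` (`dilVol_pow_four`, `one_le_dilVol`, **`dilVol_le_exp`**:
   `dilVol c n ≤ exp(n·c²/(4(1 − c²)))`).
§2 DOMINATION (`norm_cexp_neg_mul_ofReal`: `‖e^{−w·a}‖ = e^{−(Re w)·a}`; **`norm_integral_boltzmann_le`**: `‖∫ f·e^{−wS} dμ‖ ≤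
   ∫ ‖f‖·e^{−(Re w)S} dμ` for ANY complex `w`, ANY density `f`, ANY real `S` — the dilated integral is dominated by the
   absolute-value integral of the UNDILATED theory at the real coupling `Re w`; `integral_boltzmann_abs_mono`: monotone in the
   real coupling for `S ≥ 0`; `norm_cexp_weight_le`: a damping weight `e^{−t·p}`, `p ≥ 0`, keeps modulus `≤ e^{−(1−c)s·p}` on the
   disc — printed-type weights survive a dilation with `A₀ ↦ (1 − c)A₀`).
§3 THE COMPLEX GAUSSIAN NORMALISATION `gaussNorm A w = ∫_{ℝⁿ} e^{−(w/2)xᵀAx} dx` (`A ≻ 0` real, `Re w > 0`):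
   **`gaussNorm_sq_mul`** `N_A(w)²·wⁿ·det A = (2π)ⁿ` (BRANCH-FREE; from the tree theorem
   `Literature.Analysis.SpecialFunctions.sq_integral_cexp_neg_half_add_quadratic_mul_det` with the complex symmetric tilt
   `M = ((1 − w)/2)·A`), `norm_gaussNorm_sq_mul`, `gaussNorm_ne_zero`, **`volumeFactor_eq`** `‖N_A(Re w)‖²(Re w)ⁿ = ‖N_A(w)‖²‖w‖ⁿ`
   (the determinant ratio, exactly), **`norm_gaussNorm_re_le`**: on the discs, `‖N_A(Re w)‖ ≤ dilVol c n·‖N_A(w)‖`.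
§4 HOLOMORPHY of the cut-off block integral `blockInt μ f S w = ∫ f·e^{−wS} dμ` (`f` integrable, `S` measurable with `|S| ≤ S₀`
   on the block): `integrable_boltzmann` (every complex `w`), **`hasDerivAt_blockInt`** (differentiation under the integral,
   Mathlib `hasDerivAt_integral_of_dominated_loc_of_deriv_le`, dominating function `‖f‖·S₀·e^{(‖w₀‖+1)S₀}`),
   `differentiable_blockInt` (ENTIRE in `w`), `norm_blockInt_le`.
§5 THE MODEL ACTIVITY `act A μ f S z = invNorm A z · blockInt μ f S z`, normalised by the closed form `invNorm A z =
   (z/2π)^{n/2}√(det A)` (`norm_invNorm`, **`norm_invNorm_eq_inv`** `‖invNorm A z‖ = ‖N_A(z)‖⁻¹`, `invNorm_sq_mul_gaussNorm_sq`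
   `invNorm² · N_A² = 1`, `differentiableOn_invNorm` on `Re z > 0`), and the real-coupling absolute-value functional
   `absAct A μ f S r = ‖N_A(r)‖⁻¹·∫ ‖f‖e^{−rS} dμ`: `differentiableOn_act`, **`norm_act_le`** `‖act z‖ ≤ dilVol c n · absAct(Re z)`
   on the discs (DOMINATION × VOLUME FACTOR), the dilation domain `dilDom t₀ c = ⋃_{s ≥ t₀} closedBall s (c·s)`, and the two end
   results: **`act_dilationAnalytic`** — if `absAct r ≤ M` for all real `r ≥ (1 − c)t₀` (the printed KIND of input: real
   couplings, positive weights, uniform in the coupling) then `∃ D, DifferentiableOn ℂ act D ∧ (∀ z ∈ D, ‖act z‖ ≤ dilVol c n·M) ∧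
   ∀ s ≥ t₀, closedBall s (c·s) ⊆ D`, LITERALLY the `hlast` shape; **`act_lipschitz`** — `‖act s − act s′‖ ≤
   (4·dilVol c n·M/(c·t₀))·|s − s′|` for `s, s′ ≥ t₀` (`Dimock2015.real_param_lipschitz` BY NAME).
§6 CURRENCY: the memoryless model hierarchy `modelV` (`V (j+1) g = act (g j)`) satisfies the lineage's `StepTransfer` over the
   t-box `BoxWindow [t₀, ∞[` with `ℓ = 4·dilVol c n·M/(c·t₀)`, obtained by firing `stepTransfer_of_analyticOn` BY NAME with
   `hlast := act_dilationAnalytic` (**`stepTransfer_modelV`**) — the binder is inhabited by a genuine integral (the witnesses of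
   `T4CouplingAnalyticityWitness` were rational toys).
§7 SHARPNESS (v1.1): the price is EXACT and genuinely exponential — `dilVol_add` (multiplicative in the block size: paid PER
   BLOCK of fluctuation variables), `exp_le_dilVol` (`e^{n c²/4} ≤ dilVol c n`, complementing `dilVol_le_exp`), the tangency
   point `tangent s c = s·((1 − c²) + i·c·√(1 − c²))` of the disc (`norm_tangent_sub` `‖τ − s‖ = c·s`, `norm_tangent`,
   `aperture_eq_tangent`), **`volumeFactor_sharp`** `‖N_A(Re τ)‖ = dilVol c n·‖N_A(τ)‖` (equality in `norm_gaussNorm_re_le`),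
   and **`norm_act_le_sharp`** / `norm_act_le_attained`: with zero action and a non-negative insertion the disc bound
   `norm_act_le` holds with EQUALITY at `τ` — at the generality of the mechanism the constant `(1 − c²)^{−n/4}` cannot be
   improved.

WHAT THIS SHOWS AND WHAT IT DOES NOT.  Shows (kernel): the two analytic facts the dilation reading (L5) leans on hold in the
model with explicit constants — DOMINATION by the real-coupling absolute-value theory at `Re z ≥ (1 − c)s`, and the VOLUME
FACTOR `(1 − c²)^{−n/4} ≤ e^{n·c²/(4(1−c²))}` as the whole price of normalising by the dilated Gaussian —, that holomorphy in the
coupling of a cut-off Boltzmann integral with bounded action density is automatic, and that the resulting object discharges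
`hlast` and the Cauchy ⇒ Lipschitz step BY NAME.  It also makes the QUANTITATIVE CONSTRAINT of the route explicit: the sup
bound degrades by `e^{n·c²/(4(1−c²))}`, so a dilation radius `c` uniform in the step is affordable only if `c²` is of the order
of the inverse number of fluctuation variables PER LOCALISED UNIT that the printed bounds can absorb into their small
parameters — this is the precise place where a dilation parameter would have to join the printed small parameters, and it is
NOT PRINTED.  Does NOT show: [H-dil] / [H-dil-N] for Bałaban's 𝐑-operation — the model has NO logarithm, NO localisation or
polymer expansion (no `exp(−κ·d_k(X))`), NO uniformity in k or in the volume beyond the explicit `n`-dependence of `dilVol`,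
treats the cut-offs as part of a FIXED density `f` (in print they sit at the g_k-dependent thresholds of the rescaled
variables, (L2)/(L5) of `T4CouplingAnalyticity`), and ignores the Haar density, the δ-functions and the background field;
nor NE9 (cell NEW ESTIMATE, node U3).  The wall of node U3 on this route is unchanged and typed: the binder `hlast` of
`T4CouplingAnalyticity.stepTransferV_of_analyticOn` for Bałaban's step with `M₁ j = M·exp(−A₀ (log t_j)^{p₀})`
(record `t4/T4-EST-NE9-P1.md` §9, §13; GAPS G-ne9p1-1 … 12).

CITATION HEADER (lean-in-tree rule 2026-08-18).  Source quoted (STRUCTURE/CONTEXT only, p. 268 as above): T. Bałaban,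
*Renormalization group approach to lattice gauge field theories. I.*, Commun. Math. Phys. **109**, 249–301 (1987)
[Balaban1987RG1] (cell paper B12; held `paper:balaban1987-cmp109-rg-i-small-field`).  Named for framing only:
[Balaban1988RG2Cluster] (B13), [Balaban1988Convergent] (B14), [Balaban1989LargeFieldII] (B16).  The Bałaban papers are
manuscripts UNDER ADJUDICATION by the audit cell `pub-balaban`: NOTHING printed in them is asserted here.  Kernel inputs
imported BY NAME: `Literature.Analysis.SpecialFunctions.RealGaussianComplexQuadratic` (tree, sorry-free:
`sq_integral_cexp_neg_half_add_quadratic_mul_det` — the real n-dimensional Gaussian with a complex symmetric tilt, textbook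
folklore (Hörmander, *ALPDO I* Thm 7.6.1) outside the audited series), `T4CouplingAnalyticity` v1.6 (this lineage, p187391:
`BoxWindow`, `StepTransfer`, `stepTransfer_of_analyticOn`) and through it `Dimock2015.AnalyticLipschitz` (p179421:
`real_param_lipschitz` — J. Dimock's printed "analyticity ⇒ Lipschitz continuity" mechanism [Dimock2015], PUBLISHED and
outside the audited series) and Mathlib (`hasDerivAt_integral_of_dominated_loc_of_deriv_le`, `Complex.norm_cpow_real`,
`Matrix.PosDef.det_pos`); it modifies nothing.  NEW LEAF of unit `b2b-balaban-t4-ne9-p1-g8` (NE9 prover P1, analytic-dependence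
route, generation 8; journal ONLINE + CLAIM T4-U3.E-NE9-PROVE-P1h* 2026-08-19T13:40:03Z); v1 = p188799 (af59bba85743).
v1.1 (same seat, APPEND-ONLY over v1: every v1 code line byte-present in order; header §7 paragraph + this sentence added):
+ §7 SHARPNESS — the volume factor is attained on every disc (`volumeFactor_sharp`, `norm_act_le_sharp`), multiplicative in
the block size (`dilVol_add`) and two-sided exponential (`exp_le_dilVol`); 18 theorems + 1 def, all [folklore].
-/

noncomputable section

open Complex Metric Set MeasureTheory Matrix
open scoped BigOperators
open Literature.MathematicalPhysics.QuantumFieldTheory.Balaban1983to89.T4CouplingAnalyticity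

namespace Literature.MathematicalPhysics.QuantumFieldTheory.Balaban1983to89.T4ComplexDilation

/-! ## §1  Geometry of the dilation discs `|z − s| ≤ c·s` -/

/-- On the relative disc `|z − s| ≤ c·s` the real part is at least `(1 − c)·s`. [folklore] -/
theorem re_ge_of_mem_dilDisc {z : ℂ} {s c : ℝ} (hz : ‖z - s‖ ≤ c * s) : (1 - c) * s ≤ z.re := by
  have h1 : |(z - s).re| ≤ ‖z - s‖ := Complex.abs_re_le_norm _
  have h2 : (z - (s : ℂ)).re = z.re - s := by simp
  rw [h2] at h1
  have := (abs_le.1 (h1.trans hz)).1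
  linarith

/-- On the relative disc `|z − s| ≤ c·s` the modulus is at most `(1 + c)·s` (for `s ≥ 0`). [folklore] -/
theorem norm_le_of_mem_dilDisc {z : ℂ} {s c : ℝ} (hs : 0 ≤ s) (hz : ‖z - s‖ ≤ c * s) : ‖z‖ ≤ (1 + c) * s := by
  have : ‖z‖ ≤ ‖z - s‖ + ‖(s : ℂ)‖ := by
    calc ‖z‖ = ‖(z - s) + s‖ := by ring_nf
      _ ≤ ‖z - s‖ + ‖(s : ℂ)‖ := norm_add_le _ _
  rw [Complex.norm_real, Real.norm_of_nonneg hs] at this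
  linarith

/-- **The key disc inequality**: on `|z − s| ≤ c·s` one has `‖z‖²·(1 − c²) ≤ (Re z)²` — i.e.
`‖z‖/Re z ≤ (1 − c²)^{−1/2}` for `c < 1`; equality at `Re (z/s − 1) = −c²`. [folklore] -/
theorem normSq_mul_le_re_sq_of_mem_dilDisc {z : ℂ} {s c : ℝ} (hz : ‖z - s‖ ≤ c * s) :
    ‖z‖ ^ 2 * (1 - c ^ 2) ≤ z.re ^ 2 := by
  set u : ℂ := z - s with hu
  have hzu : z = s + u := by rw [hu]; ring
  have hsq : u.re ^ 2 + u.im ^ 2 = ‖u‖ ^ 2 := by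
    rw [Complex.sq_norm, Complex.normSq_apply]; ring
  have hn2 : ‖u‖ ^ 2 ≤ (c * s) ^ 2 := pow_le_pow_left₀ (norm_nonneg _) hz 2
  have hy : u.im ^ 2 ≤ (c * s) ^ 2 - u.re ^ 2 := by linarith
  have hz2 : ‖z‖ ^ 2 = (s + u.re) ^ 2 + u.im ^ 2 := by
    rw [Complex.sq_norm, Complex.normSq_apply, hzu]; simp; ring
  have hre : z.re = s + u.re := by rw [hzu]; simp
  rw [hz2, hre]
  by_cases h1c : c ^ 2 ≤ 1
  · nlinarith [mul_nonneg (sub_nonneg.2 hy) (sub_nonneg.2 h1c), sq_nonneg (u.re + c ^ 2 * s)]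
  · have h' : 0 ≤ ((s + u.re) ^ 2 + u.im ^ 2) * (c ^ 2 - 1) :=
      mul_nonneg (by positivity) (by linarith)
    nlinarith [sq_nonneg (s + u.re)]

/-- Points of the dilation discs over the box `s ≥ t₀ > 0` have positive real part (`c < 1`). [folklore] -/
theorem re_pos_of_mem_dilDisc {z : ℂ} {s c t₀ : ℝ} (ht₀ : 0 < t₀) (hc : c < 1) (hs : t₀ ≤ s)
    (hz : ‖z - s‖ ≤ c * s) : 0 < z.re :=
  lt_of_lt_of_le (mul_pos (by linarith) (lt_of_lt_of_le ht₀ hs)) (re_ge_of_mem_dilDisc hz)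

/-- The DILATION VOLUME CONSTANT `(1 − c²)^{−n/4}` (written with square roots): the bound on the Gaussian
volume factor `(‖z‖/Re z)^{n/2}` over the dilation discs, `n` = number of integration variables. [folklore] -/
def dilVol (c : ℝ) (n : ℕ) : ℝ := (Real.sqrt (Real.sqrt (1 - c ^ 2)⁻¹)) ^ n

/-- `dilVol c n ≥ 0`. [folklore] -/
theorem dilVol_nonneg (c : ℝ) (n : ℕ) : 0 ≤ dilVol c n := pow_nonneg (Real.sqrt_nonneg _) n

/-- `(dilVol c n)⁴ = (1 − c²)^{−n}` (`c² < 1`). [folklore] -/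
theorem dilVol_pow_four {c : ℝ} (hc : c ^ 2 < 1) (n : ℕ) : dilVol c n ^ 4 = ((1 - c ^ 2)⁻¹) ^ n := by
  have h0 : 0 ≤ (1 - c ^ 2)⁻¹ := inv_nonneg.2 (by linarith)
  unfold dilVol
  rw [← pow_mul, mul_comm, pow_mul]
  congr 1
  rw [show (4 : ℕ) = 2 * 2 from rfl, pow_mul, Real.sq_sqrt (Real.sqrt_nonneg _), Real.sq_sqrt h0]

/-- `1 ≤ dilVol c n` (`c² < 1`). [folklore] -/
theorem one_le_dilVol {c : ℝ} (hc : c ^ 2 < 1) (n : ℕ) : 1 ≤ dilVol c n := by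
  unfold dilVol
  refine one_le_pow₀ (Real.one_le_sqrt.2 (Real.one_le_sqrt.2 ?_))
  exact (one_le_inv₀ (by linarith)).2 (by nlinarith [sq_nonneg c])

/-- `(1 − c²)^{−n/4} ≤ exp(n·c²/(4(1 − c²)))` — the `e^{O(c²)·n}` form of the volume factor. [folklore] -/
theorem dilVol_le_exp {c : ℝ} (hc : c ^ 2 < 1) (n : ℕ) :
    dilVol c n ≤ Real.exp (n * (c ^ 2 / (4 * (1 - c ^ 2)))) := by
  have h1 : 0 < 1 - c ^ 2 := by linarith
  have key : (1 - c ^ 2)⁻¹ ≤ Real.exp (c ^ 2 / (1 - c ^ 2)) := by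
    have : (1 - c ^ 2)⁻¹ = c ^ 2 / (1 - c ^ 2) + 1 := by field_simp; ring
    rw [this]; exact Real.add_one_le_exp _
  have h4 : dilVol c n ^ 4 ≤ (Real.exp (n * (c ^ 2 / (4 * (1 - c ^ 2))))) ^ 4 := by
    rw [dilVol_pow_four hc, ← Real.exp_nat_mul]
    calc ((1 - c ^ 2)⁻¹) ^ n ≤ (Real.exp (c ^ 2 / (1 - c ^ 2))) ^ n :=
          pow_le_pow_left₀ (inv_nonneg.2 h1.le) key n
      _ = Real.exp (↑(4 : ℕ) * (↑n * (c ^ 2 / (4 * (1 - c ^ 2))))) := by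
          rw [← Real.exp_nat_mul]; congr 1; push_cast; field_simp
  exact (pow_le_pow_iff_left₀ (dilVol_nonneg c n) (Real.exp_nonneg _) (by norm_num)).1 h4

/-! ## §2  Domination: the modulus of a dilated Boltzmann factor is the undilated factor at the real part -/

/-- `‖exp(−w·a)‖ = exp(−Re w · a)` for real `a`. [folklore] -/
theorem norm_cexp_neg_mul_ofReal (w : ℂ) (a : ℝ) : ‖cexp (-(w * a))‖ = Real.exp (-(w.re * a)) := by
  rw [Complex.norm_exp]; congr 1; simp

section Domination

variable {X : Type*} [MeasurableSpace X] (μ : Measure X)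

/-- **Domination.** For any complex coupling `w`, any density `f` and any REAL action density `S`,
`‖∫ f·e^{−wS} dμ‖ ≤ ∫ ‖f‖·e^{−(Re w)S} dμ`: the dilated block integral is dominated by the ABSOLUTE-VALUE integral of
the UNDILATED theory at the real coupling `Re w` (no sign or size condition on `S`; if the right-hand side is not
integrable both sides are read with Lean's junk value `0` and the inequality still holds). [folklore] -/
theorem norm_integral_boltzmann_le (f : X → ℂ) (S : X → ℝ) (w : ℂ) :
    ‖∫ x, f x * cexp (-(w * S x)) ∂μ‖ ≤ ∫ x, ‖f x‖ * Real.exp (-(w.re * S x)) ∂μ := by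
  refine (norm_integral_le_integral_norm _).trans (le_of_eq ?_)
  refine integral_congr_ae (Filter.Eventually.of_forall fun x => ?_)
  simp only [norm_mul, norm_cexp_neg_mul_ofReal]

/-- Monotonicity of the absolute-value integral in the real coupling for a NON-NEGATIVE action density: for
`r₀ ≤ r` and `S ≥ 0`, `∫ ‖f‖e^{−rS} ≤ ∫ ‖f‖e^{−r₀S}` (integrability at `r₀` assumed). [folklore] -/
theorem integral_boltzmann_abs_mono {f : X → ℂ} {S : X → ℝ} (hS : ∀ x, 0 ≤ S x) {r₀ r : ℝ} (hr : r₀ ≤ r)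
    (hint : Integrable (fun x => ‖f x‖ * Real.exp (-(r₀ * S x))) μ) :
    ∫ x, ‖f x‖ * Real.exp (-(r * S x)) ∂μ ≤ ∫ x, ‖f x‖ * Real.exp (-(r₀ * S x)) ∂μ := by
  refine integral_mono_of_nonneg (Filter.Eventually.of_forall fun x => ?_) hint
    (Filter.Eventually.of_forall fun x => ?_)
  · exact mul_nonneg (norm_nonneg _) (Real.exp_nonneg _)
  · exact mul_le_mul_of_nonneg_left (Real.exp_le_exp.2 (by nlinarith [hS x])) (norm_nonneg _)

/-- Large-field / cut-off WEIGHTS under dilation: a printed damping factor `exp(−t·p)` (`p ≥ 0`) evaluated at a complex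
coupling of the disc `|z − s| ≤ c·s` has modulus `≤ exp(−(1 − c)·s·p)` — the weight survives with `A₀ ↦ (1 − c)A₀`.
[folklore] -/
theorem norm_cexp_weight_le {z : ℂ} {s c p : ℝ} (hp : 0 ≤ p) (hz : ‖z - s‖ ≤ c * s) :
    ‖cexp (-(z * p))‖ ≤ Real.exp (-((1 - c) * s * p)) := by
  rw [norm_cexp_neg_mul_ofReal]
  exact Real.exp_le_exp.2 (neg_le_neg (mul_le_mul_of_nonneg_right (re_ge_of_mem_dilDisc hz) hp))

end Domination

/-! ## §3  The complex Gaussian normalisation and the VOLUME FACTOR `(‖w‖/Re w)^{n/2}` -/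

section Gaussian

variable {ι : Type*} [Fintype ι] [DecidableEq ι]

/-- The Gaussian normalisation at COMPLEX coupling `w`: `N_A(w) = ∫_{ℝⁿ} exp(−(w/2)·xᵀAx) dx`. [folklore] -/
def gaussNorm (A : Matrix ι ι ℝ) (w : ℂ) : ℂ := ∫ x : ι → ℝ, cexp (-(w / 2) * ((x ⬝ᵥ (A *ᵥ x) : ℝ) : ℂ))

omit [DecidableEq ι] in
/-- The complex quadratic form of `s·A` at a real vector is `s` times the real quadratic form of `A`. [folklore] -/
theorem dotProduct_smul_map_mulVec (A : Matrix ι ι ℝ) (s : ℂ) (x : ι → ℝ) :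
    (fun i => (x i : ℂ)) ⬝ᵥ ((s • A.map Complex.ofReal) *ᵥ fun i => (x i : ℂ)) =
      s * ((x ⬝ᵥ (A *ᵥ x) : ℝ) : ℂ) := by
  simp only [dotProduct, mulVec, Matrix.smul_apply, Matrix.map_apply, smul_eq_mul]
  push_cast
  simp only [Finset.mul_sum]
  refine Finset.sum_congr rfl fun i _ => Finset.sum_congr rfl fun j _ => ?_
  ring

/-- **The complex Gaussian integral, branch-free** (from the tree's `sq_integral_cexp_neg_half_add_quadratic_mul_det`
with the complex symmetric tilt `M = ((1 − w)/2)·A`): for `A ≻ 0` and `Re w > 0`,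
`N_A(w)² · wⁿ · det A = (2π)ⁿ`. [folklore] -/
theorem gaussNorm_sq_mul (A : Matrix ι ι ℝ) (hA : A.PosDef) {w : ℂ} (hw : 0 < w.re) :
    gaussNorm A w ^ 2 * (w ^ Fintype.card ι * (A.det : ℂ)) = (2 * (Real.pi : ℂ)) ^ Fintype.card ι := by
  set M : Matrix ι ι ℂ := ((1 - w) / 2) • A.map Complex.ofReal with hM
  have hAs : A.IsSymm := by
    have h := hA.1
    rwa [Matrix.IsHermitian, conjTranspose_eq_transpose_of_trivial] at h
  have hMs : M.IsSymm := (hAs.map _).smul _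
  have hre : M.map Complex.re = ((1 - w.re) / 2) • A := by
    ext i j
    simp [hM, Matrix.smul_apply, Matrix.map_apply, Complex.mul_re]
  have hAM : (A - (2 : ℝ) • M.map Complex.re).PosDef := by
    have : A - (2 : ℝ) • M.map Complex.re = w.re • A := by
      rw [hre]; ext i j; simp [Matrix.sub_apply, Matrix.smul_apply]; ring
    rw [this]
    exact hA.smul hw
  have h := Literature.Analysis.SpecialFunctions.sq_integral_cexp_neg_half_add_quadratic_mul_det hMs hAM
  have hint : ∀ x : ι → ℝ, -(1 / 2 : ℂ) * ((x ⬝ᵥ (A *ᵥ x) : ℝ) : ℂ) +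
      (fun i => (x i : ℂ)) ⬝ᵥ (M *ᵥ fun i => (x i : ℂ)) = -(w / 2) * ((x ⬝ᵥ (A *ᵥ x) : ℝ) : ℂ) := by
    intro x; rw [hM, dotProduct_smul_map_mulVec]; ring
  simp_rw [hint] at h
  have hmat : A.map Complex.ofReal - (2 : ℂ) • M = w • A.map Complex.ofReal := by
    rw [hM, smul_smul]; ext i j; simp [Matrix.sub_apply, Matrix.smul_apply]; ring
  have hdet : (A.map Complex.ofReal).det = (A.det : ℂ) := by
    -- (the tree has this as `Literature.Probability.Distributions.det_map_ofReal`; inlined to keep the import cone minimal)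
    have h' := (RingHom.map_det Complex.ofRealHom A).symm
    rw [RingHom.mapMatrix_apply] at h'
    exact h'
  rw [hmat, det_smul, hdet] at h
  exact h

/-- The modulus form: `‖N_A(w)‖² · ‖w‖ⁿ · det A = (2π)ⁿ` (`A ≻ 0`, `Re w > 0`). [folklore] -/
theorem norm_gaussNorm_sq_mul (A : Matrix ι ι ℝ) (hA : A.PosDef) {w : ℂ} (hw : 0 < w.re) :
    ‖gaussNorm A w‖ ^ 2 * (‖w‖ ^ Fintype.card ι * A.det) = (2 * Real.pi) ^ Fintype.card ι := by
  have h := congrArg (fun z : ℂ => ‖z‖) (gaussNorm_sq_mul A hA hw)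
  simp only [norm_mul, norm_pow, Complex.norm_real, Complex.norm_ofNat,
    Real.norm_of_nonneg Real.pi_pos.le] at h
  rw [Real.norm_of_nonneg hA.det_pos.le] at h
  exact h

/-- The complex Gaussian normalisation does not vanish for `Re w > 0`. [folklore] -/
theorem gaussNorm_ne_zero (A : Matrix ι ι ℝ) (hA : A.PosDef) {w : ℂ} (hw : 0 < w.re) : gaussNorm A w ≠ 0 := by
  intro h0
  have h := gaussNorm_sq_mul A hA hw
  rw [h0] at h
  have hne : (2 * (Real.pi : ℂ)) ^ Fintype.card ι ≠ 0 :=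
    pow_ne_zero _ (mul_ne_zero two_ne_zero (Complex.ofReal_ne_zero.mpr Real.pi_pos.ne'))
  exact hne (by rw [← h]; ring)

/-- **THE VOLUME FACTOR, exact form**: `‖N_A(Re w)‖²·(Re w)ⁿ = ‖N_A(w)‖²·‖w‖ⁿ`, i.e.
`‖N_A(Re w)‖/‖N_A(w)‖ = (‖w‖/Re w)^{n/2}` — the determinant ratio of the real covariance to the dilated one.
[folklore] -/
theorem volumeFactor_eq (A : Matrix ι ι ℝ) (hA : A.PosDef) {w : ℂ} (hw : 0 < w.re) :
    ‖gaussNorm A (w.re : ℂ)‖ ^ 2 * w.re ^ Fintype.card ι = ‖gaussNorm A w‖ ^ 2 * ‖w‖ ^ Fintype.card ι := by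
  have h1 := norm_gaussNorm_sq_mul A hA hw
  have h2 := norm_gaussNorm_sq_mul A hA (w := (w.re : ℂ)) (by simpa using hw)
  rw [Complex.norm_real, Real.norm_of_nonneg hw.le] at h2
  have hdet : 0 < A.det := hA.det_pos
  have : ‖gaussNorm A (w.re : ℂ)‖ ^ 2 * w.re ^ Fintype.card ι * A.det =
      ‖gaussNorm A w‖ ^ 2 * ‖w‖ ^ Fintype.card ι * A.det := by
    rw [mul_assoc, h2, ← h1, mul_assoc]
  exact mul_right_cancel₀ hdet.ne' this

/-- **THE VOLUME FACTOR on the dilation discs**: if `‖w‖²(1 − c²) ≤ (Re w)²` (every point of a disc `|w − s| ≤ c·s`,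
§1) then `‖N_A(Re w)‖ ≤ (1 − c²)^{−n/4}·‖N_A(w)‖` — equivalently `‖N_A(w)‖⁻¹ ≤ (1 − c²)^{−n/4}·‖N_A(Re w)‖⁻¹`: dividing
by the DILATED normalisation costs at most the factor `dilVol c n = (1 − c²)^{−n/4} ≤ e^{n c²/(4(1−c²))}`. [folklore] -/
theorem norm_gaussNorm_re_le (A : Matrix ι ι ℝ) (hA : A.PosDef) {w : ℂ} (hw : 0 < w.re) {c : ℝ} (hc : c ^ 2 < 1)
    (hwc : ‖w‖ ^ 2 * (1 - c ^ 2) ≤ w.re ^ 2) :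
    ‖gaussNorm A (w.re : ℂ)‖ ≤ dilVol c (Fintype.card ι) * ‖gaussNorm A w‖ := by
  set n := Fintype.card ι
  have hV := volumeFactor_eq A hA hw
  have h1c : 0 < 1 - c ^ 2 := by linarith
  -- fourth powers: ‖N re‖⁴ re^{2n} = ‖N w‖⁴ ‖w‖^{2n} ≤ ‖N w‖⁴ re^{2n} (1-c²)^{-n}
  have hsq : (‖gaussNorm A (w.re : ℂ)‖ ^ 2 * w.re ^ n) ^ 2 = (‖gaussNorm A w‖ ^ 2 * ‖w‖ ^ n) ^ 2 := by rw [hV]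
  have hwn : (‖w‖ ^ n) ^ 2 ≤ (w.re ^ n) ^ 2 * ((1 - c ^ 2)⁻¹) ^ n := by
    have e1 : (‖w‖ ^ n) ^ 2 = (‖w‖ ^ 2) ^ n := by rw [← pow_mul, ← pow_mul, mul_comm]
    have e2 : (w.re ^ n) ^ 2 * ((1 - c ^ 2)⁻¹) ^ n = (w.re ^ 2 * (1 - c ^ 2)⁻¹) ^ n := by
      rw [mul_pow, ← pow_mul, ← pow_mul, mul_comm n 2]
    rw [e1, e2]
    refine pow_le_pow_left₀ (sq_nonneg _) ?_ n
    rw [← div_eq_mul_inv, le_div_iff₀ h1c]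
    exact hwc
  have key : (‖gaussNorm A (w.re : ℂ)‖) ^ 4 * (w.re ^ n) ^ 2 ≤
      (dilVol c n * ‖gaussNorm A w‖) ^ 4 * (w.re ^ n) ^ 2 := by
    calc ‖gaussNorm A (w.re : ℂ)‖ ^ 4 * (w.re ^ n) ^ 2
        = (‖gaussNorm A (w.re : ℂ)‖ ^ 2 * w.re ^ n) ^ 2 := by ring
      _ = (‖gaussNorm A w‖ ^ 2) ^ 2 * (‖w‖ ^ n) ^ 2 := by rw [hsq]; ring
      _ ≤ (‖gaussNorm A w‖ ^ 2) ^ 2 * ((w.re ^ n) ^ 2 * ((1 - c ^ 2)⁻¹) ^ n) :=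
          mul_le_mul_of_nonneg_left hwn (by positivity)
      _ = (dilVol c n * ‖gaussNorm A w‖) ^ 4 * (w.re ^ n) ^ 2 := by
          rw [mul_pow, dilVol_pow_four hc]; ring
  have hpos : 0 < (w.re ^ n) ^ 2 := by positivity
  have h4 := le_of_mul_le_mul_right key hpos
  exact (pow_le_pow_iff_left₀ (norm_nonneg _) (mul_nonneg (dilVol_nonneg _ _) (norm_nonneg _))
    (by norm_num)).1 h4

end Gaussian

/-! ## §4  Holomorphy in the complex coupling of a cut-off Boltzmann integral -/

section Block

variable {X : Type*} [MeasurableSpace X] (μ : Measure X)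

/-- The CUT-OFF BLOCK INTEGRAL at complex coupling `w`: `I(w) = ∫ f·e^{−wS} dμ` (`μ` the reference measure of the
block with the characteristic functions inside `f`, `S` the real action density that carries the coupling). [folklore] -/
def blockInt (f : X → ℂ) (S : X → ℝ) (w : ℂ) : ℂ := ∫ x, f x * cexp (-(w * S x)) ∂μ

omit [MeasurableSpace X] in
/-- Pointwise size of the dilated integrand when `|S| ≤ S₀`: `‖f·e^{−wS}‖ ≤ ‖f‖·e^{‖w‖S₀}`. [folklore] -/
theorem norm_boltzmann_le {f : X → ℂ} {S : X → ℝ} {S₀ : ℝ} (hS₀ : ∀ x, |S x| ≤ S₀) (w : ℂ) (x : X) :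
    ‖f x * cexp (-(w * S x))‖ ≤ ‖f x‖ * Real.exp (‖w‖ * S₀) := by
  rw [norm_mul, norm_cexp_neg_mul_ofReal]
  refine mul_le_mul_of_nonneg_left (Real.exp_le_exp.2 ?_) (norm_nonneg _)
  have h1 : -(w.re * S x) ≤ |w.re| * |S x| := by rw [← abs_mul]; exact neg_le_abs _
  have h2 : |w.re| ≤ ‖w‖ := Complex.abs_re_le_norm w
  exact h1.trans (mul_le_mul h2 (hS₀ x) (abs_nonneg _) (norm_nonneg _))

/-- Measurability of the dilated integrand. [folklore] -/
theorem aestronglyMeasurable_boltzmann {f : X → ℂ} (hf : AEStronglyMeasurable f μ) {S : X → ℝ}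
    (hS : Measurable S) (w : ℂ) : AEStronglyMeasurable (fun x => f x * cexp (-(w * S x))) μ := by
  refine hf.mul ?_
  have hc : Continuous fun a : ℝ => cexp (-(w * (a : ℂ))) := by fun_prop
  exact (hc.measurable.comp hS).aestronglyMeasurable

/-- The dilated integrand is integrable for EVERY complex coupling (`f` integrable, `S` measurable and bounded on
the block). [folklore] -/
theorem integrable_boltzmann {f : X → ℂ} (hf : Integrable f μ) {S : X → ℝ} (hS : Measurable S) {S₀ : ℝ}
    (hS₀ : ∀ x, |S x| ≤ S₀) (w : ℂ) : Integrable (fun x => f x * cexp (-(w * S x))) μ :=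
  Integrable.mono' (hf.norm.mul_const (Real.exp (‖w‖ * S₀)))
    (aestronglyMeasurable_boltzmann μ hf.aestronglyMeasurable hS w)
    (Filter.Eventually.of_forall fun x => norm_boltzmann_le hS₀ w x)

/-- **Holomorphy of the block integral in the complex coupling** (differentiation under the integral sign,
Mathlib `hasDerivAt_integral_of_dominated_loc_of_deriv_le`, dominating function `‖f‖·S₀·e^{(‖w₀‖+1)S₀}` on the unit
disc about `w₀`): `I′(w₀) = ∫ f·(−S)·e^{−w₀S} dμ`. [folklore] -/
theorem hasDerivAt_blockInt {f : X → ℂ} (hf : Integrable f μ) {S : X → ℝ} (hS : Measurable S) {S₀ : ℝ}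
    (hS₀ : ∀ x, |S x| ≤ S₀) (w₀ : ℂ) :
    HasDerivAt (blockInt μ f S) (∫ x, f x * (-(S x : ℂ) * cexp (-(w₀ * S x))) ∂μ) w₀ := by
  have hF_meas : ∀ᶠ w in nhds w₀, AEStronglyMeasurable (fun x => f x * cexp (-(w * S x))) μ :=
    Filter.Eventually.of_forall fun w => aestronglyMeasurable_boltzmann μ hf.aestronglyMeasurable hS w
  have hF_int : Integrable (fun x => f x * cexp (-(w₀ * S x))) μ := integrable_boltzmann μ hf hS hS₀ w₀
  have hF'_meas : AEStronglyMeasurable (fun x => f x * (-(S x : ℂ) * cexp (-(w₀ * S x)))) μ := by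
    refine hf.aestronglyMeasurable.mul ?_
    have hc : Continuous fun a : ℝ => -(a : ℂ) * cexp (-(w₀ * (a : ℂ))) := by fun_prop
    exact (hc.measurable.comp hS).aestronglyMeasurable
  have h_bound : ∀ᵐ x ∂μ, ∀ w ∈ Metric.ball w₀ 1,
      ‖f x * (-(S x : ℂ) * cexp (-(w * S x)))‖ ≤ ‖f x‖ * (S₀ * Real.exp ((‖w₀‖ + 1) * S₀)) := by
    refine Filter.Eventually.of_forall fun x w hw => ?_
    have hS0 : 0 ≤ S₀ := (abs_nonneg _).trans (hS₀ x)
    have hw1 : ‖w‖ ≤ ‖w₀‖ + 1 := by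
      have h := mem_ball_iff_norm.1 hw
      calc ‖w‖ = ‖(w - w₀) + w₀‖ := by rw [sub_add_cancel]
        _ ≤ ‖w - w₀‖ + ‖w₀‖ := norm_add_le _ _
        _ ≤ ‖w₀‖ + 1 := by linarith
    rw [norm_mul, norm_mul, norm_neg, Complex.norm_real, norm_cexp_neg_mul_ofReal, Real.norm_eq_abs]
    refine mul_le_mul_of_nonneg_left ?_ (norm_nonneg _)
    refine mul_le_mul (hS₀ x) (Real.exp_le_exp.2 ?_) (Real.exp_nonneg _) hS0
    have h1 : -(w.re * S x) ≤ |w.re| * |S x| := by rw [← abs_mul]; exact neg_le_abs _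
    have h2 : |w.re| ≤ ‖w‖ := Complex.abs_re_le_norm w
    calc -(w.re * S x) ≤ |w.re| * |S x| := h1
      _ ≤ ‖w‖ * S₀ := mul_le_mul h2 (hS₀ x) (abs_nonneg _) (norm_nonneg _)
      _ ≤ (‖w₀‖ + 1) * S₀ := mul_le_mul_of_nonneg_right hw1 hS0
  have bound_integrable : Integrable (fun x => ‖f x‖ * (S₀ * Real.exp ((‖w₀‖ + 1) * S₀))) μ :=
    hf.norm.mul_const _
  have h_diff : ∀ᵐ x ∂μ, ∀ w ∈ Metric.ball w₀ 1,
      HasDerivAt (fun w => f x * cexp (-(w * S x))) (f x * (-(S x : ℂ) * cexp (-(w * S x)))) w := by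
    refine Filter.Eventually.of_forall fun x w _ => ?_
    have h1 : HasDerivAt (fun w : ℂ => -(w * (S x : ℂ))) (-(1 * (S x : ℂ))) w :=
      ((hasDerivAt_id w).mul_const (S x : ℂ)).neg
    have h2 := (h1.cexp).const_mul (f x)
    rw [show f x * (-(S x : ℂ) * cexp (-(w * S x))) = f x * (cexp (-(w * S x)) * -(1 * (S x : ℂ))) by ring]
    exact h2
  exact (hasDerivAt_integral_of_dominated_loc_of_deriv_le (Metric.ball_mem_nhds w₀ one_pos)
    hF_meas hF_int hF'_meas h_bound bound_integrable h_diff).2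

/-- The block integral is an ENTIRE function of the complex coupling. [folklore] -/
theorem differentiable_blockInt {f : X → ℂ} (hf : Integrable f μ) {S : X → ℝ} (hS : Measurable S) {S₀ : ℝ}
    (hS₀ : ∀ x, |S x| ≤ S₀) : Differentiable ℂ (blockInt μ f S) :=
  fun w => (hasDerivAt_blockInt μ hf hS hS₀ w).differentiableAt

/-- Domination for the block integral (§2 restated): `‖I(w)‖ ≤ ∫ ‖f‖e^{−(Re w)S} dμ`. [folklore] -/
theorem norm_blockInt_le (f : X → ℂ) (S : X → ℝ) (w : ℂ) :
    ‖blockInt μ f S w‖ ≤ ∫ x, ‖f x‖ * Real.exp (-(w.re * S x)) ∂μ :=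
  norm_integral_boltzmann_le μ f S w

end Block

/-! ## §5  The model one-block activity: holomorphic and bounded on the dilation discs (the `hlast` shape) -/

section Model

variable {ι : Type*} [Fintype ι] [DecidableEq ι] {X : Type*} [MeasurableSpace X]

/-- The CLOSED-FORM inverse normalisation `P_A(z) = (z/2π)^{n/2}·√(det A)` (principal branch; holomorphic on
`Re z > 0`).  Its modulus is `‖N_A(z)‖⁻¹` and its square is `N_A(z)⁻²` (below), i.e. `P_A = ±N_A⁻¹` with the sign fixed
by continuity from the real axis (not needed here). [folklore] -/
def invNorm (A : Matrix ι ι ℝ) (z : ℂ) : ℂ :=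
  (z / (2 * Real.pi)) ^ (((Fintype.card ι : ℝ) / 2 : ℝ) : ℂ) * (Real.sqrt A.det : ℂ)

/-- `‖P_A(z)‖ = (‖z‖/2π)^{n/2}·√(det A)`. [folklore] -/
theorem norm_invNorm (A : Matrix ι ι ℝ) (z : ℂ) :
    ‖invNorm A z‖ = (‖z‖ / (2 * Real.pi)) ^ ((Fintype.card ι : ℝ) / 2) * Real.sqrt A.det := by
  unfold invNorm
  rw [norm_mul, Complex.norm_cpow_real, Complex.norm_real, Real.norm_of_nonneg (Real.sqrt_nonneg _),
    norm_div, Complex.norm_mul, Complex.norm_ofNat, Complex.norm_real, Real.norm_of_nonneg Real.pi_pos.le]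

/-- **`‖P_A(z)‖ = ‖N_A(z)‖⁻¹` for `Re z > 0`** (from the branch-free Gaussian formula `‖N_A(z)‖²‖z‖ⁿ det A = (2π)ⁿ`).
[folklore] -/
theorem norm_invNorm_eq_inv (A : Matrix ι ι ℝ) (hA : A.PosDef) {z : ℂ} (hz : 0 < z.re) :
    ‖invNorm A z‖ = ‖gaussNorm A z‖⁻¹ := by
  set n := Fintype.card ι
  have hdet : 0 < A.det := hA.det_pos
  have hN : 0 < ‖gaussNorm A z‖ := norm_pos_iff.2 (gaussNorm_ne_zero A hA hz)
  have h1 := norm_gaussNorm_sq_mul A hA hz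
  have hz0 : 0 ≤ ‖z‖ / (2 * Real.pi) := div_nonneg (norm_nonneg _) (by positivity)
  have hP : 0 ≤ ‖invNorm A z‖ := norm_nonneg _
  -- compare squares
  have e : ((‖z‖ / (2 * Real.pi)) ^ ((n : ℝ) / 2)) ^ 2 = (‖z‖ / (2 * Real.pi)) ^ n := by
    rw [← Real.rpow_mul_natCast hz0, show ((n : ℝ) / 2 * ((2 : ℕ) : ℝ)) = (n : ℝ) by push_cast; ring,
      Real.rpow_natCast]
  have hsqP : ‖invNorm A z‖ ^ 2 = (‖z‖ / (2 * Real.pi)) ^ n * A.det := by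
    rw [norm_invNorm A, mul_pow, Real.sq_sqrt hdet.le, e]
  have hsqN : (‖gaussNorm A z‖⁻¹) ^ 2 = (‖z‖ / (2 * Real.pi)) ^ n * A.det := by
    have h2π : (0 : ℝ) < (2 * Real.pi) ^ n := by positivity
    rw [inv_pow, div_pow, eq_comm]
    field_simp
    linear_combination h1
  have := hsqP.trans hsqN.symm
  exact (pow_left_inj₀ hP (inv_nonneg.2 hN.le) two_ne_zero).1 this

/-- `P_A(z)²·N_A(z)² = 1` exactly (`Re z > 0`): the closed form squares to the inverse square of the Gaussian
normalisation (no branch ambiguity at the level of squares). [folklore] -/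
theorem invNorm_sq_mul_gaussNorm_sq (A : Matrix ι ι ℝ) (hA : A.PosDef) {z : ℂ} (hz : 0 < z.re) :
    invNorm A z ^ 2 * gaussNorm A z ^ 2 = 1 := by
  set n := Fintype.card ι
  have hdet : 0 < A.det := hA.det_pos
  have h1 := gaussNorm_sq_mul A hA hz
  have h2π : (2 * (Real.pi : ℂ)) ^ n ≠ 0 :=
    pow_ne_zero _ (mul_ne_zero two_ne_zero (Complex.ofReal_ne_zero.mpr Real.pi_pos.ne'))
  have hz2π : z / (2 * Real.pi) ≠ 0 :=
    div_ne_zero (fun h => by simp [h] at hz) (mul_ne_zero two_ne_zero (Complex.ofReal_ne_zero.mpr Real.pi_pos.ne'))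
  have hsq : invNorm A z ^ 2 = (z / (2 * Real.pi)) ^ n * (A.det : ℂ) := by
    unfold invNorm
    rw [mul_pow, ← Complex.ofReal_pow, Real.sq_sqrt hdet.le, ← cpow_nat_mul]
    have : ((2 : ℕ) : ℂ) * (((n : ℝ) / 2 : ℝ) : ℂ) = (n : ℂ) := by push_cast; ring
    rw [this, cpow_natCast]
  rw [hsq, div_pow]
  field_simp
  linear_combination h1

/-- `P_A` is holomorphic on the right half-plane (`z/2π` lies in the slit plane). [folklore] -/
theorem differentiableOn_invNorm (A : Matrix ι ι ℝ) : DifferentiableOn ℂ (invNorm A) {z | 0 < z.re} := by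
  intro z hz
  have hz' : z / (2 * Real.pi) ∈ Complex.slitPlane := by
    left
    have : (z / (2 * Real.pi)).re = z.re / (2 * Real.pi) := by
      rw [show (2 * (Real.pi : ℂ)) = ((2 * Real.pi : ℝ) : ℂ) by push_cast; ring, Complex.div_ofReal_re]
    rw [this]; exact div_pos hz (by positivity)
  refine DifferentiableAt.differentiableWithinAt ?_
  unfold invNorm
  exact ((differentiableAt_id.div_const _).cpow_const hz').mul_const _

/-- THE MODEL ONE-BLOCK ACTIVITY at complex coupling `z`: the cut-off Boltzmann integral normalised by the DILATED free
Gaussian, `G(z) = P_A(z)·∫ f e^{−zS} dμ` with `|P_A(z)| = |N_A(z)|⁻¹`. [folklore] -/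
def act (A : Matrix ι ι ℝ) (μ : Measure X) (f : X → ℂ) (S : X → ℝ) (z : ℂ) : ℂ :=
  invNorm A z * blockInt μ f S z

/-- THE REAL-COUPLING ABSOLUTE-VALUE FUNCTIONAL: the `|f|`-expectation of the UNDILATED theory at real coupling `r`,
normalised by the real Gaussian `N_A(r)` — the quantity the printed (real-coupling) bounds control uniformly in the
coupling. [folklore] -/
def absAct (A : Matrix ι ι ℝ) (μ : Measure X) (f : X → ℂ) (S : X → ℝ) (r : ℝ) : ℝ :=
  ‖gaussNorm A (r : ℂ)‖⁻¹ * ∫ x, ‖f x‖ * Real.exp (-(r * S x)) ∂μ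

omit [DecidableEq ι] in
/-- `absAct ≥ 0`. [folklore] -/
theorem absAct_nonneg (A : Matrix ι ι ℝ) (μ : Measure X) (f : X → ℂ) (S : X → ℝ) (r : ℝ) :
    0 ≤ absAct A μ f S r :=
  mul_nonneg (inv_nonneg.2 (norm_nonneg _))
    (integral_nonneg fun _ => mul_nonneg (norm_nonneg _) (Real.exp_nonneg _))

/-- The model activity is holomorphic on the right half-plane. [folklore] -/
theorem differentiableOn_act (A : Matrix ι ι ℝ) {μ : Measure X} {f : X → ℂ} (hf : Integrable f μ) {S : X → ℝ}
    (hS : Measurable S) {S₀ : ℝ} (hS₀ : ∀ x, |S x| ≤ S₀) : DifferentiableOn ℂ (act A μ f S) {z | 0 < z.re} :=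
  (differentiableOn_invNorm A).mul (differentiable_blockInt μ hf hS hS₀).differentiableOn

/-- **DOMINATION + VOLUME FACTOR**: at a point `z` of a dilation disc (`‖z‖²(1 − c²) ≤ (Re z)²`, `Re z > 0`) the
dilated activity is bounded by `(1 − c²)^{−n/4}` times the real-coupling absolute-value functional at `Re z`:
`‖G(z)‖ ≤ dilVol c n · absAct(Re z)`. [folklore] -/
theorem norm_act_le (A : Matrix ι ι ℝ) (hA : A.PosDef) (μ : Measure X) (f : X → ℂ) (S : X → ℝ) {z : ℂ}
    (hz : 0 < z.re) {c : ℝ} (hc : c ^ 2 < 1) (hzc : ‖z‖ ^ 2 * (1 - c ^ 2) ≤ z.re ^ 2) :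
    ‖act A μ f S z‖ ≤ dilVol c (Fintype.card ι) * absAct A μ f S z.re := by
  have hNz : 0 < ‖gaussNorm A z‖ := norm_pos_iff.2 (gaussNorm_ne_zero A hA hz)
  have hNr : 0 < ‖gaussNorm A (z.re : ℂ)‖ := norm_pos_iff.2 (gaussNorm_ne_zero A hA (by simpa using hz))
  have hvol : ‖gaussNorm A z‖⁻¹ ≤ dilVol c (Fintype.card ι) * ‖gaussNorm A (z.re : ℂ)‖⁻¹ := by
    have h := norm_gaussNorm_re_le A hA hz hc hzc
    rw [inv_eq_one_div, div_le_iff₀ hNz]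
    calc (1 : ℝ) = ‖gaussNorm A (z.re : ℂ)‖ * ‖gaussNorm A (z.re : ℂ)‖⁻¹ := (mul_inv_cancel₀ hNr.ne').symm
      _ ≤ (dilVol c (Fintype.card ι) * ‖gaussNorm A z‖) * ‖gaussNorm A (z.re : ℂ)‖⁻¹ :=
          mul_le_mul_of_nonneg_right h (inv_nonneg.2 hNr.le)
      _ = dilVol c (Fintype.card ι) * ‖gaussNorm A (z.re : ℂ)‖⁻¹ * ‖gaussNorm A z‖ := by ring
  have hI : 0 ≤ ∫ x, ‖f x‖ * Real.exp (-(z.re * S x)) ∂μ :=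
    integral_nonneg fun _ => mul_nonneg (norm_nonneg _) (Real.exp_nonneg _)
  unfold act absAct
  rw [norm_mul, norm_invNorm_eq_inv A hA hz]
  calc ‖gaussNorm A z‖⁻¹ * ‖blockInt μ f S z‖
      ≤ ‖gaussNorm A z‖⁻¹ * ∫ x, ‖f x‖ * Real.exp (-(z.re * S x)) ∂μ :=
        mul_le_mul_of_nonneg_left (norm_blockInt_le μ f S z) (inv_nonneg.2 hNz.le)
    _ ≤ (dilVol c (Fintype.card ι) * ‖gaussNorm A (z.re : ℂ)‖⁻¹) * ∫ x, ‖f x‖ * Real.exp (-(z.re * S x)) ∂μ :=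
        mul_le_mul_of_nonneg_right hvol hI
    _ = dilVol c (Fintype.card ι) * (‖gaussNorm A (z.re : ℂ)‖⁻¹ * ∫ x, ‖f x‖ * Real.exp (-(z.re * S x)) ∂μ) :=
        mul_assoc _ _ _

/-- The DILATION DOMAIN over the coupling box `s ≥ t₀`: the union of the relative discs `|z − s| ≤ c·s`. [folklore] -/
def dilDom (t₀ c : ℝ) : Set ℂ := {z | ∃ s : ℝ, t₀ ≤ s ∧ ‖z - s‖ ≤ c * s}

/-- Every disc `|z − s| ≤ c·s`, `s ≥ t₀`, lies in the dilation domain. [folklore] -/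
theorem closedBall_subset_dilDom {t₀ c s : ℝ} (hs : t₀ ≤ s) : closedBall (s : ℂ) (c * s) ⊆ dilDom t₀ c :=
  fun z hz => ⟨s, hs, by rwa [mem_closedBall, dist_eq_norm] at hz⟩

/-- The dilation domain lies in the right half-plane (`t₀ > 0`, `c < 1`). [folklore] -/
theorem dilDom_subset_re_pos {t₀ c : ℝ} (ht₀ : 0 < t₀) (hc : c < 1) : dilDom t₀ c ⊆ {z | 0 < z.re} :=
  fun _ ⟨_, hs, hz⟩ => re_pos_of_mem_dilDisc ht₀ hc hs hz

/-- **THE `hlast` SHAPE WITH A GENUINE INTEGRAL.**  If the real-coupling absolute-value functional is bounded by `M`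
uniformly in the coupling `r ≥ (1 − c)t₀` (the printed KIND of bound: real couplings, positive weights), then the model
activity `G = act A μ f S` is holomorphic on a set containing every dilation disc `|z − s| ≤ c·s`, `s ≥ t₀`, and is
bounded there by `(1 − c²)^{−n/4}·M`.  This is literally the hypothesis `hlast` of
`T4CouplingAnalyticity.stepTransfer_of_analyticOn` / `ne9T_of_dilationStep` (radius `r s = c·s`, bound
`M₁ = dilVol c n · M`) for a step map that ignores the old data.  ASSERTS NOTHING about Bałaban's functionals. [folklore] -/
theorem act_dilationAnalytic (A : Matrix ι ι ℝ) (hA : A.PosDef) {μ : Measure X} {f : X → ℂ} (hf : Integrable f μ)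
    {S : X → ℝ} (hS : Measurable S) {S₀ : ℝ} (hS₀ : ∀ x, |S x| ≤ S₀) {t₀ c M : ℝ} (ht₀ : 0 < t₀) (hc0 : 0 ≤ c)
    (hc : c < 1) (hM : ∀ r : ℝ, (1 - c) * t₀ ≤ r → absAct A μ f S r ≤ M) :
    ∃ D : Set ℂ, DifferentiableOn ℂ (act A μ f S) D ∧
      (∀ z ∈ D, ‖act A μ f S z‖ ≤ dilVol c (Fintype.card ι) * M) ∧
      ∀ s ∈ Set.Ici t₀, closedBall (s : ℂ) (c * s) ⊆ D := by
  have hc2 : c ^ 2 < 1 := by nlinarith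
  refine ⟨dilDom t₀ c, (differentiableOn_act A hf hS hS₀).mono (dilDom_subset_re_pos ht₀ hc), ?_,
    fun s hs => closedBall_subset_dilDom hs⟩
  rintro z ⟨s, hs, hz⟩
  have hs0 : 0 ≤ s := ht₀.le.trans hs
  have hre : 0 < z.re := re_pos_of_mem_dilDisc ht₀ hc hs hz
  have hzc := normSq_mul_le_re_sq_of_mem_dilDisc hz
  refine (norm_act_le A hA μ f S hre hc2 hzc).trans (mul_le_mul_of_nonneg_left (hM _ ?_) (dilVol_nonneg _ _))
  calc (1 - c) * t₀ ≤ (1 - c) * s := mul_le_mul_of_nonneg_left hs (by linarith)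
    _ ≤ z.re := re_ge_of_mem_dilDisc hz

/-- **CAUCHY ⇒ LIPSCHITZ IN THE REAL COUPLING** (`Dimock2015.real_param_lipschitz` BY NAME on the discs of radius
`c·t₀`): `‖G(s) − G(s′)‖ ≤ (4·(1 − c²)^{−n/4}·M/(c·t₀))·|s − s′|` for `s, s′ ≥ t₀` — the last-coupling Lipschitz
constant `ℓ = 4M₁/(c t₀)` of the lineage's `StepTransfer`, here for a genuine normalised Boltzmann integral. [folklore] -/
theorem act_lipschitz (A : Matrix ι ι ℝ) (hA : A.PosDef) {μ : Measure X} {f : X → ℂ} (hf : Integrable f μ)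
    {S : X → ℝ} (hS : Measurable S) {S₀ : ℝ} (hS₀ : ∀ x, |S x| ≤ S₀) {t₀ c M : ℝ} (ht₀ : 0 < t₀) (hc0 : 0 < c)
    (hc : c < 1) (hM : ∀ r : ℝ, (1 - c) * t₀ ≤ r → absAct A μ f S r ≤ M) {s s' : ℝ} (hs : t₀ ≤ s)
    (hs' : t₀ ≤ s') :
    ‖act A μ f S s - act A μ f S s'‖ ≤ 4 * (dilVol c (Fintype.card ι) * M) / (c * t₀) * |s - s'| := by
  obtain ⟨D, hD, hB, hdisc⟩ := act_dilationAnalytic A hA hf hS hS₀ ht₀ hc0.le hc hM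
  have hDab : ∀ u ∈ Icc (min s s') (max s s'), closedBall (u : ℂ) (c * t₀) ⊆ D := by
    intro u hu
    have hut : t₀ ≤ u := (le_min hs hs').trans hu.1
    exact (closedBall_subset_closedBall (mul_le_mul_of_nonneg_left hut hc0.le)).trans (hdisc u hut)
  exact Literature.MathematicalPhysics.QuantumFieldTheory.Dimock2015.real_param_lipschitz (mul_pos hc0 ht₀) hD hB
    hDab ⟨min_le_left _ _, le_max_left _ _⟩ ⟨min_le_right _ _, le_max_right _ _⟩

end Model

/-! ## §6  Currency: the model activity discharges `hlast` of `stepTransfer_of_analyticOn` BY NAME -/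

section Currency

variable {ι : Type*} [Fintype ι] [DecidableEq ι] {X : Type*} [MeasurableSpace X]

/-- The MEMORYLESS model hierarchy: `V 0 = 0`, `V (j+1) g = act (g j)` — each step's activity is the model one-block activity
at the step's own (last) coupling; the old data are ignored. [folklore] -/
def modelV (A : Matrix ι ι ℝ) (μ : Measure X) (f : X → ℂ) (S : X → ℝ) : ℕ → (ℕ → ℝ) → ℂ
  | 0, _ => 0
  | j + 1, g => act A μ f S (g j : ℂ)

/-- **`hlast` INHABITED BY A GENUINE INTEGRAL, BY NAME.**  Feeding `act_dilationAnalytic` as the binder `hlast` of the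
lineage's `T4CouplingAnalyticity.stepTransfer_of_analyticOn` (box `[t₀, ∞[`, relative radius `r s = c·s`, `r₀ = c·t₀`, step map
`Φ j z w = act z` ignoring the old datum `w`, transported old data `T ≡ 0`, `ϱ = 1`, `ω₀ = 0`) yields the full-history transfer
shape `StepTransfer` for the memoryless model hierarchy with last-coupling constant `ℓ = 4·(1 − c²)^{−n/4}·M/(c·t₀)` (the
old-data constant `4·M₂/1` is moot here since `T ≡ 0`).  A currency check of the reduction, NOT an estimate for Bałaban's
activities. [folklore] -/
theorem stepTransfer_modelV (A : Matrix ι ι ℝ) (hA : A.PosDef) {μ : Measure X} {f : X → ℂ} (hf : Integrable f μ)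
    {S : X → ℝ} (hS : Measurable S) {S₀ : ℝ} (hS₀ : ∀ x, |S x| ≤ S₀) {t₀ c M : ℝ} (ht₀ : 0 < t₀) (hc0 : 0 < c)
    (hc : c < 1) (hM : ∀ r : ℝ, (1 - c) * t₀ ≤ r → absAct A μ f S r ≤ M) :
    StepTransfer (modelV A μ f S) (BoxWindow (Set.Ici t₀)) (4 * (dilVol c (Fintype.card ι) * M) / (c * t₀))
      (4 * (dilVol c (Fintype.card ι) * M) / 1) 0 := by
  obtain ⟨D, hD, hB, hdisc⟩ := act_dilationAnalytic A hA hf hS hS₀ ht₀ hc0.le hc hM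
  refine stepTransfer_of_analyticOn (V := modelV A μ f S) Set.ordConnected_Ici (fun _ _ => (0 : ℂ))
    (fun _ z _ => act A μ f S z) (fun s => c * s) (mul_pos hc0 ht₀)
    (fun s hs => mul_le_mul_of_nonneg_left (Set.mem_Ici.1 hs) hc0.le) one_pos ?_ ?_ ?_ ?_
  · intro j g _
    rfl
  · intro j g _
    exact ⟨D, hD, hB, hdisc⟩
  · intro j s hs
    exact ⟨Set.univ, differentiableOn_const _,
      fun w _ => hB _ (hdisc s hs (mem_closedBall_self (mul_nonneg hc0.le (ht₀.le.trans (Set.mem_Ici.1 hs))))),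
      fun g _ => Set.subset_univ _⟩
  · intro j g _ g' _
    simp only [sub_self, norm_zero]
    exact Finset.sum_nonneg fun m _ => mul_nonneg (pow_nonneg le_rfl _) (norm_nonneg _)

end Currency

/-! ## §7  Sharpness (v1.1): the volume factor is ATTAINED on every disc, MULTIPLICATIVE in the block size, and genuinely
exponential in `n·c²` -/

section Sharpness

variable {ι : Type*} [Fintype ι] [DecidableEq ι] {X : Type*} [MeasurableSpace X]

/-- No dilation, no price: `dilVol 0 n = 1`. [folklore] -/
theorem dilVol_zero_radius (n : ℕ) : dilVol 0 n = 1 := by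
  simp [dilVol]

/-- MULTIPLICATIVITY in the number of fluctuation variables: `dilVol c (m + n) = dilVol c m · dilVol c n` — for a block
decomposition of the fluctuation variables the price is paid PER BLOCK (the honest kernel form of «a factor `e^{O(c²)·n_X}` per
localised unit `X`»). [folklore] -/
theorem dilVol_add (c : ℝ) (m n : ℕ) : dilVol c (m + n) = dilVol c m * dilVol c n := pow_add _ _ _

/-- Monotone in the block size (`c² < 1`). [folklore] -/
theorem dilVol_mono {c : ℝ} (hc : c ^ 2 < 1) {m n : ℕ} (h : m ≤ n) : dilVol c m ≤ dilVol c n := by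
  have h1 : 1 ≤ Real.sqrt (Real.sqrt (1 - c ^ 2)⁻¹) := by
    have := one_le_dilVol hc 1
    rwa [dilVol, pow_one] at this
  exact pow_le_pow_right₀ h1 h

/-- `(dilVol c n)² = (√((1 − c²)⁻¹))ⁿ = (1 − c²)^{−n/2}`. [folklore] -/
theorem dilVol_sq (c : ℝ) (n : ℕ) : dilVol c n ^ 2 = (Real.sqrt (1 - c ^ 2)⁻¹) ^ n := by
  unfold dilVol
  rw [← pow_mul, mul_comm, pow_mul, Real.sq_sqrt (Real.sqrt_nonneg _)]

/-- The growth of the volume factor is GENUINELY exponential in `n·c²`: `exp(n·c²/4) ≤ dilVol c n` (`c² < 1`; together with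
`dilVol_le_exp`: `e^{n c²/4} ≤ (1 − c²)^{−n/4} ≤ e^{n c²/(4(1−c²))}`). [folklore] -/
theorem exp_le_dilVol {c : ℝ} (hc : c ^ 2 < 1) (n : ℕ) :
    Real.exp (n * (c ^ 2 / 4)) ≤ dilVol c n := by
  have h1 : 0 < 1 - c ^ 2 := by linarith
  have key : Real.exp (c ^ 2) ≤ (1 - c ^ 2)⁻¹ := by
    rw [le_inv_comm₀ (Real.exp_pos _) h1, ← Real.exp_neg]
    have := Real.add_one_le_exp (-(c ^ 2))
    linarith
  have h4 : (Real.exp (n * (c ^ 2 / 4))) ^ 4 ≤ dilVol c n ^ 4 := by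
    rw [dilVol_pow_four hc, ← Real.exp_nat_mul]
    calc Real.exp (↑(4 : ℕ) * (↑n * (c ^ 2 / 4))) = Real.exp (c ^ 2) ^ n := by
            rw [← Real.exp_nat_mul]; congr 1; push_cast; ring
      _ ≤ ((1 - c ^ 2)⁻¹) ^ n := pow_le_pow_left₀ (Real.exp_nonneg _) key n
  exact (pow_le_pow_iff_left₀ (Real.exp_nonneg _) (dilVol_nonneg c n) (by norm_num)).1 h4

/-- The TANGENCY POINT `τ(s,c) = s·((1 − c²) + i·c·√(1 − c²))` of the disc `|z − s| ≤ c·s`: the boundary point at which the ray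
from the vertex `0` touches the disc, i.e. where the aperture inequality `‖z‖²(1 − c²) ≤ (Re z)²` of §1 is an equality.
[folklore] -/
def tangent (s c : ℝ) : ℂ := ⟨s * (1 - c ^ 2), s * (c * Real.sqrt (1 - c ^ 2))⟩

/-- `Re τ(s,c) = s(1 − c²)`. [folklore] -/
@[simp] theorem tangent_re (s c : ℝ) : (tangent s c).re = s * (1 - c ^ 2) := rfl

/-- `Im τ(s,c) = s·c·√(1 − c²)`. [folklore] -/
@[simp] theorem tangent_im (s c : ℝ) : (tangent s c).im = s * (c * Real.sqrt (1 - c ^ 2)) := rfl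

/-- `τ(s,c)` lies ON the boundary circle: `‖τ − s‖ = c·s` (`s ≥ 0`, `0 ≤ c`, `c² ≤ 1`). [folklore] -/
theorem norm_tangent_sub {s c : ℝ} (hs : 0 ≤ s) (hc0 : 0 ≤ c) (hc : c ^ 2 ≤ 1) : ‖tangent s c - s‖ = c * s := by
  have hq : 0 ≤ 1 - c ^ 2 := by linarith
  have h3 : Real.sqrt (1 - c ^ 2) ^ 2 = 1 - c ^ 2 := Real.sq_sqrt hq
  have hsq : ‖tangent s c - s‖ ^ 2 = (c * s) ^ 2 := by
    rw [Complex.sq_norm, Complex.normSq_apply]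
    simp only [sub_re, sub_im, tangent_re, tangent_im, ofReal_re, ofReal_im, sub_zero]
    linear_combination (s ^ 2 * c ^ 2) * h3
  exact (pow_left_inj₀ (norm_nonneg _) (mul_nonneg hc0 hs) two_ne_zero).1 hsq

/-- `‖τ(s,c)‖ = s·√(1 − c²)` (`s ≥ 0`, `c² ≤ 1`). [folklore] -/
theorem norm_tangent {s c : ℝ} (hs : 0 ≤ s) (hc : c ^ 2 ≤ 1) : ‖tangent s c‖ = s * Real.sqrt (1 - c ^ 2) := by
  have hq : 0 ≤ 1 - c ^ 2 := by linarith
  have h3 : Real.sqrt (1 - c ^ 2) ^ 2 = 1 - c ^ 2 := Real.sq_sqrt hq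
  have hsq : ‖tangent s c‖ ^ 2 = (s * Real.sqrt (1 - c ^ 2)) ^ 2 := by
    rw [Complex.sq_norm, Complex.normSq_apply, tangent_re, tangent_im]
    linear_combination (s ^ 2 * (c ^ 2 - 1)) * h3
  exact (pow_left_inj₀ (norm_nonneg _) (mul_nonneg hs (Real.sqrt_nonneg _)) two_ne_zero).1 hsq

/-- At `τ(s,c)` the aperture inequality of §1 is an EQUALITY: `‖τ‖²(1 − c²) = (Re τ)²`. [folklore] -/
theorem aperture_eq_tangent {s c : ℝ} (hs : 0 ≤ s) (hc : c ^ 2 ≤ 1) :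
    ‖tangent s c‖ ^ 2 * (1 - c ^ 2) = (tangent s c).re ^ 2 := by
  rw [norm_tangent hs hc, tangent_re, mul_pow, Real.sq_sqrt (by linarith)]
  ring

/-- `Re τ(s,c) > 0` for `s > 0`, `c² < 1`. [folklore] -/
theorem tangent_re_pos {s c : ℝ} (hs : 0 < s) (hc : c ^ 2 < 1) : 0 < (tangent s c).re := by
  rw [tangent_re]
  exact mul_pos hs (by linarith)

/-- **THE VOLUME FACTOR IS ATTAINED.**  At the tangency point `τ = τ(s,c)` of the disc `|w − s| ≤ c·s` (`s > 0`, `c² < 1`;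
no sign condition on `c`: `τ(s,−c) = conj τ(s,c)`): `‖N_A(Re τ)‖ = dilVol c n · ‖N_A(τ)‖` — the inequality `norm_gaussNorm_re_le` is an equality there, so
`(1 − c²)^{−n/4}` is the EXACT price of normalising by the dilated Gaussian on the disc, not an artefact of the proof.
[folklore] -/
theorem volumeFactor_sharp (A : Matrix ι ι ℝ) (hA : A.PosDef) {s c : ℝ} (hs : 0 < s) (hc : c ^ 2 < 1) :
    ‖gaussNorm A ((tangent s c).re : ℂ)‖ = dilVol c (Fintype.card ι) * ‖gaussNorm A (tangent s c)‖ := by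
  have hq : 0 < 1 - c ^ 2 := by linarith
  have hτ : 0 < (tangent s c).re := tangent_re_pos hs hc
  have hV := volumeFactor_eq A hA hτ
  have hnorm : ‖tangent s c‖ = s * Real.sqrt (1 - c ^ 2) := norm_tangent hs.le hc.le
  have hre' : (tangent s c).re = ‖tangent s c‖ * Real.sqrt (1 - c ^ 2) := by
    rw [tangent_re, hnorm, mul_assoc, Real.mul_self_sqrt hq.le]
  have hτn : 0 < ‖tangent s c‖ := by
    rw [hnorm]; exact mul_pos hs (Real.sqrt_pos.2 hq)
  have hpow : (tangent s c).re ^ Fintype.card ι = ‖tangent s c‖ ^ Fintype.card ι * Real.sqrt (1 - c ^ 2) ^ Fintype.card ι := by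
    rw [hre', mul_pow]
  rw [hpow] at hV
  have hτn' : ‖tangent s c‖ ^ Fintype.card ι ≠ 0 := pow_ne_zero _ hτn.ne'
  have hqn : Real.sqrt (1 - c ^ 2) ^ Fintype.card ι ≠ 0 := pow_ne_zero _ (Real.sqrt_pos.2 hq).ne'
  have h1 : ‖gaussNorm A ((tangent s c).re : ℂ)‖ ^ 2 * Real.sqrt (1 - c ^ 2) ^ Fintype.card ι
      = ‖gaussNorm A (tangent s c)‖ ^ 2 := by
    apply mul_right_cancel₀ hτn'
    rw [← hV]; ring
  have hsq : ‖gaussNorm A ((tangent s c).re : ℂ)‖ ^ 2 = (dilVol c (Fintype.card ι) * ‖gaussNorm A (tangent s c)‖) ^ 2 := by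
    rw [mul_pow, dilVol_sq, Real.sqrt_inv, inv_pow, mul_comm ((Real.sqrt (1 - c ^ 2) ^ Fintype.card ι)⁻¹),
      eq_mul_inv_iff_mul_eq₀ hqn]
    exact h1
  exact (pow_left_inj₀ (norm_nonneg _) (mul_nonneg (dilVol_nonneg _ _) (norm_nonneg _)) two_ne_zero).1 hsq

/-- Summary: on EVERY dilation disc `|w − s| ≤ c·s` (`s > 0`, `0 ≤ c`, `c² < 1`) there is a boundary point with positive real
part at which the volume factor `(1 − c²)^{−n/4}` of `norm_gaussNorm_re_le` is attained. [folklore] -/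
theorem volumeFactor_attained (A : Matrix ι ι ℝ) (hA : A.PosDef) {s c : ℝ} (hs : 0 < s) (hc0 : 0 ≤ c) (hc : c ^ 2 < 1) :
    ∃ w : ℂ, ‖w - s‖ = c * s ∧ 0 < w.re ∧
      ‖gaussNorm A (w.re : ℂ)‖ = dilVol c (Fintype.card ι) * ‖gaussNorm A w‖ :=
  ⟨tangent s c, norm_tangent_sub hs.le hc0 hc.le, tangent_re_pos hs hc, volumeFactor_sharp A hA hs hc⟩

/-- With ZERO action the block integral is the constant `∫ f dμ`. [folklore] -/
theorem blockInt_action_zero (μ : Measure X) (f : X → ℂ) (z : ℂ) :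
    blockInt μ f (fun _ => 0) z = ∫ x, f x ∂μ := by
  simp [blockInt]

omit [DecidableEq ι] in
/-- With zero action and a non-negative insertion `f = g ≥ 0` the real-coupling functional is `‖N_A(r)‖⁻¹·∫ g dμ`.
[folklore] -/
theorem absAct_action_zero (A : Matrix ι ι ℝ) (μ : Measure X) {g : X → ℝ} (hg : ∀ x, 0 ≤ g x) (r : ℝ) :
    absAct A μ (fun x => (g x : ℂ)) (fun _ => 0) r = ‖gaussNorm A (r : ℂ)‖⁻¹ * ∫ x, g x ∂μ := by
  unfold absAct
  congr 1
  refine integral_congr_ae (Filter.Eventually.of_forall fun x => ?_)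
  simp only [mul_zero, neg_zero, Real.exp_zero, mul_one, Complex.norm_real, Real.norm_eq_abs, abs_of_nonneg (hg x)]

/-- Zero action, non-negative insertion, `Re z > 0`: `‖act z‖ = ‖N_A(z)‖⁻¹·∫ g dμ`. [folklore] -/
theorem norm_act_action_zero (A : Matrix ι ι ℝ) (hA : A.PosDef) (μ : Measure X) {g : X → ℝ} (hg : ∀ x, 0 ≤ g x)
    {z : ℂ} (hz : 0 < z.re) :
    ‖act A μ (fun x => (g x : ℂ)) (fun _ => 0) z‖ = ‖gaussNorm A z‖⁻¹ * ∫ x, g x ∂μ := by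
  rw [act, norm_mul, norm_invNorm_eq_inv A hA hz, blockInt_action_zero, integral_complex_ofReal, Complex.norm_real,
    Real.norm_of_nonneg (integral_nonneg hg)]

/-- **`norm_act_le` IS ATTAINED.**  Zero action, non-negative insertion, tangency point `τ(s,c)`:
`‖act τ‖ = dilVol c n · absAct(Re τ)` — DOMINATION (§2) and the VOLUME FACTOR (§3) are simultaneously equalities, so at the
generality of the mechanism (bounded action over a fixed reference measure, normalisation by the dilated Gaussian) the
constant `(1 − c²)^{−n/4}` of `norm_act_le` / `act_dilationAnalytic` cannot be improved. [folklore] -/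
theorem norm_act_le_sharp (A : Matrix ι ι ℝ) (hA : A.PosDef) (μ : Measure X) {g : X → ℝ} (hg : ∀ x, 0 ≤ g x)
    {s c : ℝ} (hs : 0 < s) (hc : c ^ 2 < 1) :
    ‖act A μ (fun x => (g x : ℂ)) (fun _ => 0) (tangent s c)‖
      = dilVol c (Fintype.card ι) * absAct A μ (fun x => (g x : ℂ)) (fun _ => 0) (tangent s c).re := by
  have hτ : 0 < (tangent s c).re := tangent_re_pos hs hc
  have hd : dilVol c (Fintype.card ι) ≠ 0 := (lt_of_lt_of_le one_pos (one_le_dilVol hc _)).ne'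
  rw [norm_act_action_zero A hA μ hg hτ, absAct_action_zero A μ hg, volumeFactor_sharp A hA hs hc, mul_inv,
    ← mul_assoc, ← mul_assoc, mul_inv_cancel₀ hd, one_mul]

/-- Summary: on EVERY dilation disc there are a boundary point and honest data (zero action, the constant insertion `1` over a
finite reference measure) for which the disc bound `norm_act_le` holds with EQUALITY. [folklore] -/
theorem norm_act_le_attained (A : Matrix ι ι ℝ) (hA : A.PosDef) (μ : Measure X) {s c : ℝ} (hs : 0 < s) (hc0 : 0 ≤ c)
    (hc : c ^ 2 < 1) :
    ∃ z : ℂ, ‖z - s‖ = c * s ∧ 0 < z.re ∧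
      ‖act A μ (fun _ => ((1 : ℝ) : ℂ)) (fun _ => 0) z‖
        = dilVol c (Fintype.card ι) * absAct A μ (fun _ => ((1 : ℝ) : ℂ)) (fun _ => 0) z.re :=
  ⟨tangent s c, norm_tangent_sub hs.le hc0 hc.le, tangent_re_pos hs hc,
    norm_act_le_sharp A hA μ (g := fun _ => (1 : ℝ)) (fun _ => zero_le_one) hs hc⟩

end Sharpness

end Literature.MathematicalPhysics.QuantumFieldTheory.Balaban1983to89.T4ComplexDilation

end
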